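import Literature.NumberTheory.ComplexMultiplication.CMOrderQuadraticBass
import HarnessLib

/-!
# The ideal class monoid stratified by multiplicator rings: `#ICM(𝔯) = Σ_S #ICM_S(𝔯)` over the over-orders
# `S` of any order, and `#ICM(𝔬) = Σ_S #Pic(S)` for a quadratic order (Marseglia 2019 §3, Lemma 3.6 and
# Prop. 3.7 «`ICM(R) = ⊔ Pic(S)`», counted)

Family `hodge`, lane `lit-hodgefound` (Track 2 foundations library; seat p15, row g24-#2 — the COUNT behind row
g24-#1 `CMOrderQuadraticBass` «every order of a quadratic field is Bass»), topic
`Literature/NumberTheory/ComplexMultiplication`.  THEOREMS ONLY: no definition, no instance, no named fact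
(D-0026, net Literature debt `0`).  Carriers BY NAME: the order `𝔯 = endOrder ρ` / `𝔬 = endOrder (Algebra.leftMulMatrix μ)`,
`FractionalIdeal 𝔯⁰ K`, the classes `M ∼ xN` of `ICM(𝔯)` written inline as Mathlib's `Quot`
(`CMOrderIdealClassMonoidFinite.finite_quot_fractionalIdeal`), the over-orders
`{S : Subring K | 𝔯 ≤ S ∧ Module.Finite ℤ S}` (`EndOrder.finite_setOf_overorder`), the multiplicator ring
`(M : M) = M / M` (`CMOrderOverordersIdempotents` §4), Mathlib's `ClassGroup S` (`= Pic(S)`, the invertible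
fractional ideals modulo the principal ones) and the lattice `L(I) = (↑I).restrictScalars ℤ` of
`CMLatticeInvertibleIdeals`.

## Source, VERBATIM

S. Marseglia, *Computing the ideal class monoid of an order*, J. Lond. Math. Soc. (2) 101 (2020) 984–1007
[Marseglia2019], held `paper:arxiv-1805.09671`, §3 p. 6 (chunk p0006):

> **Lemma 3.6.** Let `R` be an order in `K`. If two fractional `R`-ideals `I` and `J` are isomorphic then they
> have the same multiplicator ring. *Proof.* […] there exists `x ∈ K^×` such that `I = xJ`. Hence
> `(I:I) = (xJ:xJ) = (J:J)` […]. It follows that `ICM(R) ⊇ ⊔ Pic(S)` where the disjoint union is taken over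
> the set of over-orders `S` of `R`. […] **Proposition 3.7.** The following are equivalent: (a) `R` is Bass,
> (b) the inclusion in (eq:icmsuppics) is an equality, (c) `ICM(R)` is Clifford.

with §2 p. 5 «Observe that every order in a quadratic number field is a Bass order» and §2 p. 4 «there are only
finitely many over-orders».  (§6 p. 12 counts `ICM(R)` stratum by stratum: «`ICM(R) = ⊔_S ICM_S(R)` […] where
`S` runs over the over-orders of `R` and `ICM_S(R)` denotes the classes with multiplicator ring `S`» — the
partition by LEMMA 3.6 used in Algorithm `ComputeICM`.)

## What is formalised

* §1 (ANY order `𝔯 = endOrder ρ` of any number field — LEMMA 3.6 counted): the classes of `ICM(𝔯)` are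
  partitioned by their multiplicator ring, an over-order of `𝔯`:
  `EndOrder.equivalence_exists_eq_spanSingleton_mul` (`M ∼ xN` is an equivalence relation),
  `EndOrder.nonempty_quot_stratum_equiv_fiber` and **`EndOrder.natCard_quot_fractionalIdeal_eq_sum_natCard_quot_stratum`**:
  `#ICM(𝔯) = Σ_{S over-order} #ICM_S(𝔯)`, `ICM_S(𝔯)` = the classes of the nonzero fractional ideals `M` with
  `(M : M) = S` (the sum over the finite set `EndOrder.finite_setOf_overorder`).
* §2 (quadratic `K`, `𝔬 = endOrder (M_μ)`, `μ : Basis (Fin 2) ℚ K`; an over-order written as the order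
  `𝔬′ = endOrder (M_ν)` of a lattice basis `ν` with `𝔬 ≤ 𝔬′`): PROP. 3.7 (b) stratum by stratum —
  `existsUnique_units_restrictScalars_coe_eq_of_coe_div_self_eq` (a fractional `𝔬`-ideal with multiplicator ring
  `𝔬′` has the lattice of a UNIQUE invertible fractional `𝔬′`-ideal — Cox's Prop. 7.4 for the order `𝔬′`,
  `CMLatticeInvertibleIdeals` §2), `existsUnique_coe_restrictScalars_eq_of_units` (conversely an invertible
  `𝔬′`-ideal is the lattice of a unique fractional `𝔬`-ideal, whose multiplicator ring is `𝔬′`),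
  `nonempty_quot_stratum_equiv_classGroup` and **`natCard_quot_stratum_eq_natCard_classGroup`**:
  `#ICM_{𝔬′}(𝔬) = #Pic(𝔬′) = Nat.card (ClassGroup 𝔬′)`.
* §3 **`natCard_quot_fractionalIdeal_eq_sum_natCard_classGroup`**: `#ICM(𝔬) = Σ_{S over-order of 𝔬} #Pic(S)` —
  «`ICM(R) = ⊔ Pic(S)`» for the Bass order `𝔬`, as a count over the finite set of over-orders (each of which is
  the order of a lattice, `exists_basis_coe_span_eq_and_endOrder_eq`); and `natCard_classGroup_le_natCard_quot_fractionalIdeal`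
  (`#Pic(𝔬) ≤ #ICM(𝔬)`, the stratum `S = 𝔬`).

NOT formalised: the monoid structure of `ICM`, weak equivalence classes (§4–§5), the algorithms (§6).

## References
* [Marseglia2019] S. Marseglia, *Computing the ideal class monoid of an order*, J. Lond. Math. Soc. (2) 101
  (2020) 984–1007, §3 Lemma 3.6, «`ICM(R) ⊇ ⊔ Pic(S)`», Prop. 3.7 (p. 6); §2 p. 5; §6 p. 12.
  [cite: Marseglia2019, §3 Lemma 3.6 and Prop. 3.7, p. 6]
* [Cox2013] D. A. Cox, *Primes of the Form x² + ny²*, 2nd ed., Wiley 2013, §7.A Prop. 7.4 and the definition of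
  `C(𝒪) = I(𝒪)/P(𝒪)`, pp. 135–136. [cite: Cox2013, §7.A Prop. 7.4, pp. 135–136]
* [DadeTausskyZassenhaus1962] E. C. Dade, O. Taussky, H. Zassenhaus, *On the theory of orders …*, Math. Ann. 148
  (1962) 31–64 (the semigroup of ideal classes of an order). [cite: DadeTausskyZassenhaus1962, §1]
-/

noncomputable section

open scoped nonZeroDivisors NumberField Pointwise
open NumberField Module FractionalIdeal

namespace Literature.NumberTheory.ComplexMultiplication

/-! ## §1 Any order: `ICM(𝔯)` is partitioned by the multiplicator ring — `#ICM(𝔯) = Σ_S #ICM_S(𝔯)` -/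

namespace EndOrder

section AnyOrder

variable {K : Type} [Field K] [NumberField K]
variable {ι : Type} [Fintype ι] [DecidableEq ι] {ρ : K →ₐ[ℚ] Matrix ι ι ℚ}
variable [IsFractionRing (endOrder ρ) K]

/-- **`M ∼ N :⟺ M = xN` (`x ∈ K^×`) is an equivalence relation on the nonzero fractional ideals** (Marseglia's
`ICM(R) = 𝓘(R)/𝓟(R)`, Cor. 3.4), here on any set of nonzero fractional ideals cut out by a predicate `p`.
[cite: Marseglia2019, §3 Def. 3.1 / Cor. 3.4, p. 6] -/
theorem equivalence_exists_eq_spanSingleton_mul (p : FractionalIdeal (endOrder ρ)⁰ K → Prop) :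
    Equivalence fun M N : {M : FractionalIdeal (endOrder ρ)⁰ K // p M} =>
      ∃ x : K, x ≠ 0 ∧ (M : FractionalIdeal (endOrder ρ)⁰ K) = spanSingleton (endOrder ρ)⁰ x * N := by
  refine ⟨fun M => ⟨1, one_ne_zero, by rw [spanSingleton_one, one_mul]⟩, ?_, ?_⟩
  · rintro M N ⟨x, hx0, h⟩
    refine ⟨x⁻¹, inv_ne_zero hx0, ?_⟩
    rw [h, ← mul_assoc, spanSingleton_mul_spanSingleton, inv_mul_cancel₀ hx0, spanSingleton_one, one_mul]
  · rintro M N P ⟨x, hx0, h⟩ ⟨y, hy0, h'⟩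
    refine ⟨x * y, mul_ne_zero hx0 hy0, ?_⟩
    rw [h, h', ← mul_assoc, spanSingleton_mul_spanSingleton]

variable [Nonempty ι]

omit [Nonempty ι] in
/-- **The stratum `ICM_S(𝔯)` is the fibre of `[M] ↦ (M : M)` over the over-order `S`**: for every function
`f` on the classes that agrees with the multiplicator ring (`f [M] = (M:M)` as subsets of `K`), the classes of the
nonzero fractional ideals with `(M : M) = S` (modulo `K^×`) are in bijection with `{q // f q = S}` — LEMMA 3.6
(«isomorphic ideals have the same multiplicator ring») makes `f` exist. [cite: Marseglia2019, §3 Lemma 3.6, p. 6] -/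
theorem nonempty_quot_stratum_equiv_fiber (S : Subring K)
    (f : (Quot fun M N : {M : FractionalIdeal (endOrder ρ)⁰ K // M ≠ 0} =>
      ∃ x : K, x ≠ 0 ∧ (M : FractionalIdeal (endOrder ρ)⁰ K) = spanSingleton (endOrder ρ)⁰ x * N) → Subring K)
    (hf : ∀ M : {M : FractionalIdeal (endOrder ρ)⁰ K // M ≠ 0},
      ((f (Quot.mk _ M) : Subring K) : Set K) =
        (((M : FractionalIdeal (endOrder ρ)⁰ K) / M : FractionalIdeal (endOrder ρ)⁰ K) : Set K)) :
    Nonempty ((Quot fun M N : {M : FractionalIdeal (endOrder ρ)⁰ K //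
        M ≠ 0 ∧ ((M / M : FractionalIdeal (endOrder ρ)⁰ K) : Set K) = S} =>
      ∃ x : K, x ≠ 0 ∧ (M : FractionalIdeal (endOrder ρ)⁰ K) = spanSingleton (endOrder ρ)⁰ x * N) ≃
      {q : Quot fun M N : {M : FractionalIdeal (endOrder ρ)⁰ K // M ≠ 0} =>
        ∃ x : K, x ≠ 0 ∧ (M : FractionalIdeal (endOrder ρ)⁰ K) = spanSingleton (endOrder ρ)⁰ x * N // f q = S}) := by
  -- the map on representatives
  let φ₀ : {M : FractionalIdeal (endOrder ρ)⁰ K // M ≠ 0 ∧ ((M / M : FractionalIdeal (endOrder ρ)⁰ K) : Set K) = S} →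
      {q : Quot fun M N : {M : FractionalIdeal (endOrder ρ)⁰ K // M ≠ 0} =>
        ∃ x : K, x ≠ 0 ∧ (M : FractionalIdeal (endOrder ρ)⁰ K) = spanSingleton (endOrder ρ)⁰ x * N // f q = S} :=
    fun M => ⟨Quot.mk _ ⟨M.1, M.2.1⟩, SetLike.coe_injective ((hf ⟨M.1, M.2.1⟩).trans M.2.2)⟩
  have hφ₀ : ∀ M N : {M : FractionalIdeal (endOrder ρ)⁰ K // M ≠ 0 ∧ ((M / M : FractionalIdeal (endOrder ρ)⁰ K) : Set K) = S},
      (∃ x : K, x ≠ 0 ∧ (M : FractionalIdeal (endOrder ρ)⁰ K) = spanSingleton (endOrder ρ)⁰ x * N) → φ₀ M = φ₀ N := by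
    rintro M N ⟨x, hx0, h⟩
    exact Subtype.ext (Quot.sound ⟨x, hx0, h⟩)
  refine ⟨Equiv.ofBijective (Quot.lift φ₀ hφ₀) ⟨?_, ?_⟩⟩
  · -- injective: equal classes in `ICM(𝔯)` are related (the relation is an equivalence relation)
    intro q₁ q₂ h
    induction q₁ using Quot.ind with
    | mk M =>
      induction q₂ using Quot.ind with
      | mk N =>
        have h' : Quot.mk (fun M N : {M : FractionalIdeal (endOrder ρ)⁰ K // M ≠ 0} =>
            ∃ x : K, x ≠ 0 ∧ (M : FractionalIdeal (endOrder ρ)⁰ K) = spanSingleton (endOrder ρ)⁰ x * N) ⟨M.1, M.2.1⟩ =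
            Quot.mk _ ⟨N.1, N.2.1⟩ := congrArg Subtype.val h
        obtain ⟨x, hx0, hx⟩ := ((equivalence_exists_eq_spanSingleton_mul (p := fun M : FractionalIdeal (endOrder ρ)⁰ K => M ≠ 0)).eqvGen_iff).1
          (Quot.eqvGen_exact h')
        exact Quot.sound ⟨x, hx0, hx⟩
  · -- surjective: a class over `S` has its representatives in the stratum
    rintro ⟨q, hq⟩
    induction q using Quot.ind with
    | mk M =>
      have hM : ((M.1 / M.1 : FractionalIdeal (endOrder ρ)⁰ K) : Set K) = S := by
        rw [← hf M, hq]
      exact ⟨Quot.mk _ ⟨M.1, M.2, hM⟩, rfl⟩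

/-- **LEMMA 3.6 counted — `#ICM(𝔯) = Σ_S #ICM_S(𝔯)` over the over-orders `S` of `𝔯`**: the (finitely many,
`CMOrderIdealClassMonoidFinite`) classes of nonzero fractional `𝔯`-ideals modulo `K^×` are partitioned by their
multiplicator ring `(M : M)` — an over-order of `𝔯` (`exists_overorder_coe_eq_div_self`), the same along a class
(`spanSingleton_mul_div_spanSingleton_mul`) —, the over-orders being finitely many (`finite_setOf_overorder`).
Valid for every order of every number field. [cite: Marseglia2019, §3 Lemma 3.6 and «`ICM(R) ⊇ ⊔ Pic(S)`», p. 6]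
[cite: DadeTausskyZassenhaus1962, §1] -/
theorem natCard_quot_fractionalIdeal_eq_sum_natCard_quot_stratum :
    Nat.card (Quot fun M N : {M : FractionalIdeal (endOrder ρ)⁰ K // M ≠ 0} =>
      ∃ x : K, x ≠ 0 ∧ (M : FractionalIdeal (endOrder ρ)⁰ K) = spanSingleton (endOrder ρ)⁰ x * N) =
      ∑ S ∈ (finite_setOf_overorder (ρ := ρ) (K := K)).toFinset,
        Nat.card (Quot fun M N : {M : FractionalIdeal (endOrder ρ)⁰ K //
            M ≠ 0 ∧ ((M / M : FractionalIdeal (endOrder ρ)⁰ K) : Set K) = S} =>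
          ∃ x : K, x ≠ 0 ∧ (M : FractionalIdeal (endOrder ρ)⁰ K) = spanSingleton (endOrder ρ)⁰ x * N) := by
  classical
  -- the multiplicator ring, as a function to the over-orders
  have hmr : ∀ M : {M : FractionalIdeal (endOrder ρ)⁰ K // M ≠ 0}, ∃ S : Subring K,
      endOrder ρ ≤ S ∧ Module.Finite ℤ S ∧ (S : Set K) = ((M.1 / M.1 : FractionalIdeal (endOrder ρ)⁰ K) : Set K) :=
    fun M => exists_overorder_coe_eq_div_self M.2
  choose mr hmr𝔯 hmrfin hmrS using hmr
  have hresp : ∀ M N : {M : FractionalIdeal (endOrder ρ)⁰ K // M ≠ 0},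
      (∃ x : K, x ≠ 0 ∧ (M : FractionalIdeal (endOrder ρ)⁰ K) = spanSingleton (endOrder ρ)⁰ x * N) → mr M = mr N := by
    rintro M N ⟨x, hx0, h⟩
    apply SetLike.coe_injective
    rw [hmrS, hmrS, h, spanSingleton_mul_div_spanSingleton_mul hx0 N.2]
  set f : (Quot fun M N : {M : FractionalIdeal (endOrder ρ)⁰ K // M ≠ 0} =>
      ∃ x : K, x ≠ 0 ∧ (M : FractionalIdeal (endOrder ρ)⁰ K) = spanSingleton (endOrder ρ)⁰ x * N) → Subring K :=
    Quot.lift mr hresp with hfdef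
  have hfS : ∀ q, f q ∈ (finite_setOf_overorder (ρ := ρ) (K := K)).toFinset := by
    intro q
    induction q using Quot.ind with
    | mk M =>
      rw [Set.Finite.mem_toFinset]
      exact ⟨hmr𝔯 M, hmrfin M⟩
  -- count fibrewise
  haveI : Finite (Quot fun M N : {M : FractionalIdeal (endOrder ρ)⁰ K // M ≠ 0} =>
      ∃ x : K, x ≠ 0 ∧ (M : FractionalIdeal (endOrder ρ)⁰ K) = spanSingleton (endOrder ρ)⁰ x * N) :=
    finite_quot_fractionalIdeal
  letI := Fintype.ofFinite (Quot fun M N : {M : FractionalIdeal (endOrder ρ)⁰ K // M ≠ 0} =>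
      ∃ x : K, x ≠ 0 ∧ (M : FractionalIdeal (endOrder ρ)⁰ K) = spanSingleton (endOrder ρ)⁰ x * N)
  rw [Nat.card_eq_fintype_card, ← Finset.card_univ, Finset.card_eq_sum_card_fiberwise fun q _ => hfS q]
  refine Finset.sum_congr rfl fun S _ => ?_
  rw [← Fintype.card_subtype, ← Nat.card_eq_fintype_card]
  exact Nat.card_congr (nonempty_quot_stratum_equiv_fiber S f fun M => hmrS M).some.symm

end AnyOrder

end EndOrder

/-! ## §2 Quadratic orders: the stratum over the over-order `𝔬′` is `Pic(𝔬′)` — `#ICM_{𝔬′}(𝔬) = #ClassGroup 𝔬′` -/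

namespace CMTypeLattice

section Stratum

variable {K : Type} [Field K] [NumberField K]
variable (μ ν : Basis (Fin 2) ℚ K) [IsFractionRing (endOrder (Algebra.leftMulMatrix μ)) K]

/-- The multiplicator ring read on lattices: if `(M : M) = 𝔬′ = endOrder (M_ν)` as subsets of `K`, then
`(L(M) : L(M)) = (𝔪′ : 𝔪′)` for `𝔪′ = ⊕ ℤνⱼ` (`L(M/M) = L(M)/L(M)`, `𝔬′ = 𝔪′/𝔪′` elementwise).
[cite: Marseglia2019, §3 Lemma 3.6, p. 6] [cite: Cox2013, §7.A («𝒪 = {β ∈ K : β𝔞 ⊂ 𝔞}»), p. 135] -/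
theorem restrictScalars_coe_div_self_eq_of_coe_div_self_eq {M : FractionalIdeal (endOrder (Algebra.leftMulMatrix μ))⁰ K}
    (hM : M ≠ 0) (hS : ((M / M : FractionalIdeal (endOrder (Algebra.leftMulMatrix μ))⁰ K) : Set K) =
      (endOrder (Algebra.leftMulMatrix ν) : Set K)) :
    (M : Submodule (endOrder (Algebra.leftMulMatrix μ)) K).restrictScalars ℤ /
        (M : Submodule (endOrder (Algebra.leftMulMatrix μ)) K).restrictScalars ℤ =
      Submodule.span ℤ (Set.range ν) / Submodule.span ℤ (Set.range ν) := by
  rw [← restrictScalars_coe_div_endOrder μ M M hM]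
  ext x
  rw [Submodule.restrictScalars_mem, ← mem_endOrder_iff_mem_div_self ν]
  have hx : x ∈ ((M / M : FractionalIdeal (endOrder (Algebra.leftMulMatrix μ))⁰ K) : Set K) ↔
      x ∈ (endOrder (Algebra.leftMulMatrix ν) : Set K) := by rw [hS]
  rw [SetLike.mem_coe, SetLike.mem_coe] at hx
  exact hx

/-- **A fractional `𝔬`-ideal with multiplicator ring `𝔬′` IS an invertible fractional `𝔬′`-ideal** — COX'S
PROP. 7.4 for the order `𝔬′` («proper ⟹ invertible», `CMLatticeInvertibleIdeals.existsUnique_units_restrictScalars_coe_eq`):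
its lattice `L(M) = ⊕ ℤν′ⱼ` has order `𝔬′`, so it is the lattice of a UNIQUE `I ∈ (FractionalIdeal 𝔬′⁰ K)ˣ`
(«every fractional `R`-ideal `I` is invertible in its own multiplicator ring `S`. This means that `[I]` is in
`Pic(S)`»). [cite: Marseglia2019, §3 Prop. 3.7 (a)⇒(b), p. 6] [cite: Cox2013, §7.A Prop. 7.4, p. 135] -/
theorem existsUnique_units_restrictScalars_coe_eq_of_coe_div_self_eq
    {M : FractionalIdeal (endOrder (Algebra.leftMulMatrix μ))⁰ K} (hM : M ≠ 0)
    (hS : ((M / M : FractionalIdeal (endOrder (Algebra.leftMulMatrix μ))⁰ K) : Set K) =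
      (endOrder (Algebra.leftMulMatrix ν) : Set K)) :
    ∃! I : (FractionalIdeal (endOrder (Algebra.leftMulMatrix ν))⁰ K)ˣ,
      ((I : FractionalIdeal (endOrder (Algebra.leftMulMatrix ν))⁰ K) :
          Submodule (endOrder (Algebra.leftMulMatrix ν)) K).restrictScalars ℤ =
        (M : Submodule (endOrder (Algebra.leftMulMatrix μ)) K).restrictScalars ℤ := by
  have h2 : finrank ℚ K = 2 := by rw [finrank_eq_card_basis μ, Fintype.card_fin]
  haveI := isFractionRing_endOrder (Algebra.leftMulMatrix ν)
  obtain ⟨ν', hν'⟩ := exists_basis_span_eq_restrictScalars_coe μ hM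
  rw [← hν']
  refine existsUnique_units_restrictScalars_coe_eq h2 ν ν' ?_
  rw [hν']
  exact restrictScalars_coe_div_self_eq_of_coe_div_self_eq μ ν hM hS

omit [IsFractionRing (endOrder (Algebra.leftMulMatrix μ)) K] in
/-- A `ℤ`-submodule `A` with `𝔬′A ⊆ A` for an over-order `𝔬 ≤ 𝔬′` is `𝔬`-stable: `(𝔪 : 𝔪)·A ⊆ A`.
[cite: Marseglia2019, §2 («the biggest over-order of `R` for which `I` is a fractional ideal»), p. 4] -/
theorem div_self_span_mul_le_of_le {A : Submodule ℤ K}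
    (hle : endOrder (Algebra.leftMulMatrix μ) ≤ endOrder (Algebra.leftMulMatrix ν))
    (hA : (Submodule.span ℤ (Set.range ν) / Submodule.span ℤ (Set.range ν)) * A ≤ A) :
    (Submodule.span ℤ (Set.range μ) / Submodule.span ℤ (Set.range μ)) * A ≤ A := by
  have h : Submodule.span ℤ (Set.range μ) / Submodule.span ℤ (Set.range μ) ≤
      Submodule.span ℤ (Set.range ν) / Submodule.span ℤ (Set.range ν) := fun x hx => by
    rw [← mem_endOrder_iff_mem_div_self μ] at hx
    rw [← mem_endOrder_iff_mem_div_self ν]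
    exact hle hx
  exact le_trans (mul_le_mul' h le_rfl) hA

/-- **Conversely an invertible fractional `𝔬′`-ideal IS (the lattice of) a UNIQUE fractional `𝔬`-ideal, for any
over-order `𝔬 ≤ 𝔬′`** (an `𝔬′`-module is an `𝔬`-module; finitely generated over `ℤ`, hence fractional).
[cite: Marseglia2019, §2 («a finitely generated sub-`R`-module `I` of `K` […] with `I ⊗ ℚ = K`»), p. 4] -/
theorem existsUnique_coe_restrictScalars_eq_of_units
    (hle : endOrder (Algebra.leftMulMatrix μ) ≤ endOrder (Algebra.leftMulMatrix ν))
    (I : (FractionalIdeal (endOrder (Algebra.leftMulMatrix ν))⁰ K)ˣ) :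
    ∃! M : FractionalIdeal (endOrder (Algebra.leftMulMatrix μ))⁰ K,
      (M : Submodule (endOrder (Algebra.leftMulMatrix μ)) K).restrictScalars ℤ =
        ((I : FractionalIdeal (endOrder (Algebra.leftMulMatrix ν))⁰ K) :
          Submodule (endOrder (Algebra.leftMulMatrix ν)) K).restrictScalars ℤ := by
  -- the lattice `A = L′(I)` is `𝔬`-stable, so an `𝔬`-submodule `M₀`
  obtain ⟨M₀, hM₀⟩ : ∃ M₀ : Submodule (endOrder (Algebra.leftMulMatrix μ)) K, M₀.restrictScalars ℤ =
      ((I : FractionalIdeal (endOrder (Algebra.leftMulMatrix ν))⁰ K) :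
        Submodule (endOrder (Algebra.leftMulMatrix ν)) K).restrictScalars ℤ :=
    exists_submodule_restrictScalars_eq μ (div_self_span_mul_le_of_le μ ν hle
      (div_self_mul_restrictScalars_le ν ((I : FractionalIdeal (endOrder (Algebra.leftMulMatrix ν))⁰ K) :
        Submodule (endOrder (Algebra.leftMulMatrix ν)) K)))
  -- `M₀` is finitely generated over `𝔬` (by the `ℤ`-generators of `A`)
  have hfgA : (((I : FractionalIdeal (endOrder (Algebra.leftMulMatrix ν))⁰ K) :
      Submodule (endOrder (Algebra.leftMulMatrix ν)) K).restrictScalars ℤ).FG := fg_restrictScalars_coe ν _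
  have hfg : M₀.FG := by
    obtain ⟨s, hs⟩ := hfgA
    refine ⟨s, le_antisymm (Submodule.span_le.2 fun x hx => ?_) fun x hx => ?_⟩
    · have hx' : x ∈ M₀.restrictScalars ℤ := by
        rw [hM₀, ← hs]
        exact Submodule.subset_span hx
      exact hx'
    · have hx' : x ∈ M₀.restrictScalars ℤ := hx
      rw [hM₀, ← hs] at hx'
      exact Submodule.span_le_restrictScalars ℤ (endOrder (Algebra.leftMulMatrix μ)) (s : Set K) hx'
  refine ⟨⟨M₀, isFractional_of_fg hfg⟩, hM₀, fun M hM => ?_⟩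
  apply eq_of_restrictScalars_coe_eq_endOrder μ
  rw [hM]
  exact hM₀.symm

/-- … and that fractional `𝔬`-ideal is nonzero with multiplicator ring `𝔬′` (PROP. 7.4, invertible ⟹ proper:
`(L(I) : L(I)) = 𝔬′` for `I ∈ I(𝔬′)`, `restrictScalars_coe_div_self_eq`). [cite: Cox2013, §7.A Prop. 7.4, p. 135]
[cite: Marseglia2019, §3 («Since being invertible is a property of the ideal class … `Pic(R) ⊆ ICM(R)`»), p. 6] -/
theorem ne_zero_and_coe_div_self_eq_of_restrictScalars_eq (I : (FractionalIdeal (endOrder (Algebra.leftMulMatrix ν))⁰ K)ˣ)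
    {M : FractionalIdeal (endOrder (Algebra.leftMulMatrix μ))⁰ K}
    (hM : (M : Submodule (endOrder (Algebra.leftMulMatrix μ)) K).restrictScalars ℤ =
      ((I : FractionalIdeal (endOrder (Algebra.leftMulMatrix ν))⁰ K) :
        Submodule (endOrder (Algebra.leftMulMatrix ν)) K).restrictScalars ℤ) :
    M ≠ 0 ∧ ((M / M : FractionalIdeal (endOrder (Algebra.leftMulMatrix μ))⁰ K) : Set K) =
      (endOrder (Algebra.leftMulMatrix ν) : Set K) := by
  have hM0 : M ≠ 0 := by
    intro h0
    have hI0 : (I : FractionalIdeal (endOrder (Algebra.leftMulMatrix ν))⁰ K) ≠ 0 := Units.ne_zero I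
    have hbot : ((I : FractionalIdeal (endOrder (Algebra.leftMulMatrix ν))⁰ K) :
        Submodule (endOrder (Algebra.leftMulMatrix ν)) K) ≠ ⊥ := fun h =>
      hI0 (coeToSubmodule_injective (h.trans coe_zero.symm))
    obtain ⟨x, hxI, hx0⟩ := Submodule.exists_mem_ne_zero_of_ne_bot hbot
    have hxM : x ∈ (M : Submodule (endOrder (Algebra.leftMulMatrix μ)) K).restrictScalars ℤ := by rw [hM]; exact hxI
    rw [h0, coe_zero, Submodule.restrictScalars_bot, Submodule.mem_bot] at hxM
    exact hx0 hxM
  refine ⟨hM0, ?_⟩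
  have hL : (M : Submodule (endOrder (Algebra.leftMulMatrix μ)) K).restrictScalars ℤ /
      (M : Submodule (endOrder (Algebra.leftMulMatrix μ)) K).restrictScalars ℤ =
      Submodule.span ℤ (Set.range ν) / Submodule.span ℤ (Set.range ν) := by
    rw [hM, restrictScalars_coe_div_self_eq ν I]
  rw [← restrictScalars_coe_div_endOrder μ M M hM0] at hL
  ext x
  rw [SetLike.mem_coe, ← FractionalIdeal.mem_coe, ← Submodule.restrictScalars_mem ℤ, hL,
    ← mem_endOrder_iff_mem_div_self ν, SetLike.mem_coe]

/-- **PROP. 3.7 (b), one stratum: `ICM_{𝔬′}(𝔬) ≃ Pic(𝔬′)`** — the classes modulo `K^×` of the nonzero fractional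
`𝔬`-ideals with multiplicator ring the over-order `𝔬′ = endOrder (M_ν) ⊇ 𝔬` are in bijection with Mathlib's
`ClassGroup 𝔬′` (`[M] ↦ [I_M]`, `L(I_M) = L(M)`; principal ideals correspond to principal ideals,
`L(xI) = x·L(I)`). [cite: Marseglia2019, §3 Prop. 3.7 (a)⇒(b) («`[I]` is in `Pic(S)`»), p. 6]
[cite: Cox2013, §7.A Prop. 7.4 and `C(𝒪) = I(𝒪)/P(𝒪)`, pp. 135–136] -/
theorem nonempty_quot_stratum_equiv_classGroup
    (hle : endOrder (Algebra.leftMulMatrix μ) ≤ endOrder (Algebra.leftMulMatrix ν)) :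
    Nonempty ((Quot fun M N : {M : FractionalIdeal (endOrder (Algebra.leftMulMatrix μ))⁰ K //
        M ≠ 0 ∧ ((M / M : FractionalIdeal (endOrder (Algebra.leftMulMatrix μ))⁰ K) : Set K) =
          (endOrder (Algebra.leftMulMatrix ν) : Set K)} =>
      ∃ x : K, x ≠ 0 ∧ (M : FractionalIdeal (endOrder (Algebra.leftMulMatrix μ))⁰ K) =
        spanSingleton (endOrder (Algebra.leftMulMatrix μ))⁰ x * N) ≃
      ClassGroup (endOrder (Algebra.leftMulMatrix ν))) := by
  haveI := isFractionRing_endOrder (Algebra.leftMulMatrix ν)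
  -- the unit `I_M` of `𝔬′` with the lattice of `M`
  have hU := fun M : {M : FractionalIdeal (endOrder (Algebra.leftMulMatrix μ))⁰ K //
      M ≠ 0 ∧ ((M / M : FractionalIdeal (endOrder (Algebra.leftMulMatrix μ))⁰ K) : Set K) =
        (endOrder (Algebra.leftMulMatrix ν) : Set K)} =>
    existsUnique_units_restrictScalars_coe_eq_of_coe_div_self_eq μ ν M.2.1 M.2.2
  let u : {M : FractionalIdeal (endOrder (Algebra.leftMulMatrix μ))⁰ K //
      M ≠ 0 ∧ ((M / M : FractionalIdeal (endOrder (Algebra.leftMulMatrix μ))⁰ K) : Set K) =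
        (endOrder (Algebra.leftMulMatrix ν) : Set K)} → (FractionalIdeal (endOrder (Algebra.leftMulMatrix ν))⁰ K)ˣ :=
    fun M => (hU M).exists.choose
  have hu : ∀ M, ((u M : FractionalIdeal (endOrder (Algebra.leftMulMatrix ν))⁰ K) :
      Submodule (endOrder (Algebra.leftMulMatrix ν)) K).restrictScalars ℤ =
      (M.1 : Submodule (endOrder (Algebra.leftMulMatrix μ)) K).restrictScalars ℤ := fun M => (hU M).exists.choose_spec
  -- uniqueness of the unit with a given lattice
  have huniq : ∀ I J : (FractionalIdeal (endOrder (Algebra.leftMulMatrix ν))⁰ K)ˣ,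
      ((I : FractionalIdeal (endOrder (Algebra.leftMulMatrix ν))⁰ K) :
          Submodule (endOrder (Algebra.leftMulMatrix ν)) K).restrictScalars ℤ =
        ((J : FractionalIdeal (endOrder (Algebra.leftMulMatrix ν))⁰ K) :
          Submodule (endOrder (Algebra.leftMulMatrix ν)) K).restrictScalars ℤ → I = J :=
    fun I J h => Units.ext (eq_of_restrictScalars_coe_eq_endOrder ν h)
  -- the class map
  let g : {M : FractionalIdeal (endOrder (Algebra.leftMulMatrix μ))⁰ K //
      M ≠ 0 ∧ ((M / M : FractionalIdeal (endOrder (Algebra.leftMulMatrix μ))⁰ K) : Set K) =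
        (endOrder (Algebra.leftMulMatrix ν) : Set K)} → ClassGroup (endOrder (Algebra.leftMulMatrix ν)) :=
    fun M => ClassGroup.mk K (u M)
  -- principal units of `𝔬′` die in the class group
  have hprin : ∀ (x : K) (hx : x ≠ 0),
      ClassGroup.mk K (toPrincipalIdeal (endOrder (Algebra.leftMulMatrix ν)) K (Units.mk0 x hx)) = 1 := fun x hx => by
    rw [ClassGroup.mk_eq_one_iff, coe_toPrincipalIdeal, Units.val_mk0, coe_spanSingleton]
    exact ⟨x, rfl⟩
  -- `M = xN ⟹ u M = (x) · u N`
  have hux : ∀ (M N : {M : FractionalIdeal (endOrder (Algebra.leftMulMatrix μ))⁰ K //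
      M ≠ 0 ∧ ((M / M : FractionalIdeal (endOrder (Algebra.leftMulMatrix μ))⁰ K) : Set K) =
        (endOrder (Algebra.leftMulMatrix ν) : Set K)}) (x : K) (hx : x ≠ 0),
      (M : FractionalIdeal (endOrder (Algebra.leftMulMatrix μ))⁰ K) =
        spanSingleton (endOrder (Algebra.leftMulMatrix μ))⁰ x * N →
      u M = toPrincipalIdeal (endOrder (Algebra.leftMulMatrix ν)) K (Units.mk0 x hx) * u N := by
    intro M N x hx h
    apply huniq
    rw [hu M, Units.val_mul, coe_toPrincipalIdeal, Units.val_mk0, restrictScalars_coe_spanSingleton_mul_endOrder, hu N, h,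
      restrictScalars_coe_spanSingleton_mul_endOrder]
  have hg : ∀ M N : {M : FractionalIdeal (endOrder (Algebra.leftMulMatrix μ))⁰ K //
      M ≠ 0 ∧ ((M / M : FractionalIdeal (endOrder (Algebra.leftMulMatrix μ))⁰ K) : Set K) =
        (endOrder (Algebra.leftMulMatrix ν) : Set K)},
      (∃ x : K, x ≠ 0 ∧ (M : FractionalIdeal (endOrder (Algebra.leftMulMatrix μ))⁰ K) =
        spanSingleton (endOrder (Algebra.leftMulMatrix μ))⁰ x * N) ↔ g M = g N := by
    intro M N
    constructor
    · rintro ⟨x, hx0, h⟩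
      show ClassGroup.mk K (u M) = ClassGroup.mk K (u N)
      rw [hux M N x hx0 h, map_mul, hprin x hx0, one_mul]
    · intro h
      have h' : ClassGroup.mk K (u M * (u N)⁻¹) = 1 := by
        rw [map_mul, map_inv, mul_inv_eq_one]
        exact h
      rw [ClassGroup.mk_eq_one_iff, isPrincipal_iff] at h'
      obtain ⟨x, hx⟩ := h'
      have huM : (u M : FractionalIdeal (endOrder (Algebra.leftMulMatrix ν))⁰ K) =
          spanSingleton (endOrder (Algebra.leftMulMatrix ν))⁰ x * u N := by
        rw [← hx, ← Units.val_mul, inv_mul_cancel_right]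
      have hx0 : x ≠ 0 := by
        rintro rfl
        rw [spanSingleton_zero, zero_mul] at huM
        exact Units.ne_zero (u M) huM
      refine ⟨x, hx0, eq_of_restrictScalars_coe_eq_endOrder μ ?_⟩
      rw [← hu M, huM, restrictScalars_coe_spanSingleton_mul_endOrder, restrictScalars_coe_spanSingleton_mul_endOrder,
        hu N]
  refine ⟨Equiv.ofBijective (Quot.lift g fun M N h => (hg M N).1 h) ⟨fun q₁ q₂ h => ?_, fun c => ?_⟩⟩
  · induction q₁ using Quot.ind with
    | mk M =>
      induction q₂ using Quot.ind with
      | mk N => exact Quot.sound ((hg M N).2 h)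
  · -- surjective: an invertible `𝔬′`-ideal is a fractional `𝔬`-ideal with multiplicator ring `𝔬′`
    refine ClassGroup.induction K (fun I => ?_) c
    obtain ⟨M, hM, -⟩ := existsUnique_coe_restrictScalars_eq_of_units μ ν hle I
    obtain ⟨hM0, hMS⟩ := ne_zero_and_coe_div_self_eq_of_restrictScalars_eq μ ν I hM
    refine ⟨Quot.mk _ ⟨M, hM0, hMS⟩, ?_⟩
    show g ⟨M, hM0, hMS⟩ = ClassGroup.mk K I
    have hI : u ⟨M, hM0, hMS⟩ = I := huniq _ _ (by rw [hu, hM])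
    show ClassGroup.mk K (u ⟨M, hM0, hMS⟩) = ClassGroup.mk K I
    rw [hI]

/-- **`#ICM_{𝔬′}(𝔬) = #Pic(𝔬′)`** for every over-order `𝔬′ = endOrder (M_ν) ⊇ 𝔬` of the quadratic order `𝔬`.
[cite: Marseglia2019, §3 Prop. 3.7 (b), p. 6] [cite: Cox2013, §7.A Prop. 7.4, pp. 135–136] -/
theorem natCard_quot_stratum_eq_natCard_classGroup
    (hle : endOrder (Algebra.leftMulMatrix μ) ≤ endOrder (Algebra.leftMulMatrix ν)) :
    Nat.card (Quot fun M N : {M : FractionalIdeal (endOrder (Algebra.leftMulMatrix μ))⁰ K //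
        M ≠ 0 ∧ ((M / M : FractionalIdeal (endOrder (Algebra.leftMulMatrix μ))⁰ K) : Set K) =
          (endOrder (Algebra.leftMulMatrix ν) : Set K)} =>
      ∃ x : K, x ≠ 0 ∧ (M : FractionalIdeal (endOrder (Algebra.leftMulMatrix μ))⁰ K) =
        spanSingleton (endOrder (Algebra.leftMulMatrix μ))⁰ x * N) =
      Nat.card (ClassGroup (endOrder (Algebra.leftMulMatrix ν))) :=
  Nat.card_congr (nonempty_quot_stratum_equiv_classGroup μ ν hle).some

/-- **The invertible stratum: `#ICM_𝔬(𝔬) = #Pic(𝔬)`** (`ν = μ`: the classes with multiplicator ring `𝔬` itself are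
the invertible ones, §2 of `CMOrderQuadraticBass`). [cite: Marseglia2019, §3 Def. 3.5 («`Pic(R) ⊆ ICM(R)`»), p. 6] -/
theorem natCard_quot_stratum_self_eq_natCard_classGroup :
    Nat.card (Quot fun M N : {M : FractionalIdeal (endOrder (Algebra.leftMulMatrix μ))⁰ K //
        M ≠ 0 ∧ ((M / M : FractionalIdeal (endOrder (Algebra.leftMulMatrix μ))⁰ K) : Set K) =
          (endOrder (Algebra.leftMulMatrix μ) : Set K)} =>
      ∃ x : K, x ≠ 0 ∧ (M : FractionalIdeal (endOrder (Algebra.leftMulMatrix μ))⁰ K) =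
        spanSingleton (endOrder (Algebra.leftMulMatrix μ))⁰ x * N) =
      Nat.card (ClassGroup (endOrder (Algebra.leftMulMatrix μ))) :=
  natCard_quot_stratum_eq_natCard_classGroup μ μ le_rfl

end Stratum

/-! ## §3 `#ICM(𝔬) = Σ_S #Pic(S)` over the over-orders of a quadratic order -/

section Count

variable {K : Type} [Field K] [NumberField K]
variable {ι : Type} [Fintype ι] [DecidableEq ι] (μ : Basis ι ℚ K)

/-- **Every over-order is the order of a lattice**: an over-order `S ⊇ 𝔬` (module-finite over `ℤ`) of the order
`𝔬 = endOrder (M_μ)` of a lattice `⊕ ℤμⱼ` is `⊕ ℤνⱼ` for a `ℚ`-basis `ν` of `K`, and `S = (S : S) = endOrder (M_ν)`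
(any degree). [cite: Marseglia2019, §2 («over-orders […] the fractional `R`-ideals that are rings»; Lemma 2.2), p. 4] -/
theorem exists_basis_coe_span_eq_and_endOrder_eq {S : Subring K} (h𝔬 : endOrder (Algebra.leftMulMatrix μ) ≤ S)
    (hfin : Module.Finite ℤ S) :
    ∃ ν : Basis ι ℚ K, (Submodule.span ℤ (Set.range ν) : Set K) = S ∧ endOrder (Algebra.leftMulMatrix ν) = S := by
  -- `S` as a `ℤ`-submodule `A` of `K`
  set A : Submodule ℤ K := AddSubgroup.toIntSubmodule S.toAddSubgroup with hA
  have hmemA : ∀ x : K, x ∈ A ↔ x ∈ S := fun x => Iff.rfl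
  -- `A` is finitely generated (it is `S`, module-finite over `ℤ`)
  have hfg : A.FG := by
    haveI := hfin
    let e : S ≃ₗ[ℤ] A :=
      { toFun := fun x => ⟨x.1, (hmemA x.1).2 x.2⟩
        invFun := fun x => ⟨x.1, (hmemA x.1).1 x.2⟩
        left_inv := fun _ => rfl
        right_inv := fun _ => rfl
        map_add' := fun _ _ => rfl
        map_smul' := fun _ _ => rfl }
    haveI : Module.Finite ℤ A := Module.Finite.equiv e
    exact Module.Finite.iff_fg.1 inferInstance
  -- `A ⊇ 𝔬` spans `K` over `ℚ`
  have htop : ⊤ ≤ Submodule.span ℚ (A : Set K) := by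
    refine le_trans (top_le_span_restrictScalars_coe μ (I := 1) one_ne_zero) (Submodule.span_mono fun x hx => ?_)
    rw [restrictScalars_coe_one_eq_div_self, SetLike.mem_coe, ← mem_endOrder_iff_mem_div_self] at hx
    exact (hmemA x).2 (h𝔬 hx)
  obtain ⟨ν, hν⟩ := exists_basis_span_eq_of_fg μ A hfg htop
  have hνS : (Submodule.span ℤ (Set.range ν) : Set K) = S := by rw [hν]; rfl
  refine ⟨ν, hνS, ?_⟩
  ext α
  rw [mem_endOrder_leftMulMatrix_iff_forall, hν]
  constructor
  · intro h
    have h1 := h 1 ((hmemA 1).2 S.one_mem)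
    rw [mul_one] at h1
    exact (hmemA α).1 h1
  · intro hα x hx
    exact (hmemA _).2 (S.mul_mem hα ((hmemA x).1 hx))

/-- **MARSEGLIA'S PROP. 3.7 (b) «`ICM(R) = ⊔ Pic(S)`» FOR A QUADRATIC ORDER, AS A COUNT:
`#ICM(𝔬) = Σ_{S over-order of 𝔬} #Pic(S)`** — the number of classes of nonzero fractional ideals of the order
`𝔬 = endOrder (M_μ)` of a lattice in a quadratic field, modulo `K^×`, is the sum over the finitely many over-orders
`𝔬 ≤ S ⊆ 𝒪_K` of the orders of their Picard groups `ClassGroup S` (§1 stratification + §2 `ICM_S(𝔬) ≃ Pic(S)`,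
every over-order being the order of a lattice). E.g. `#ICM(ℤ[√-3]) = #Pic(ℤ[√-3]) + #Pic(ℤ[ζ₃]) = 1 + 1 = 2`
(`CMOrderIdealClassMonoidFinite.natCard_quot_fractionalIdeal_eq_two`). [cite: Marseglia2019, §3 Prop. 3.7 and §2
(«every order in a quadratic number field is a Bass order»), pp. 5–6] [cite: Cox2013, §7.A Prop. 7.4, pp. 135–136] -/
theorem natCard_quot_fractionalIdeal_eq_sum_natCard_classGroup (μ : Basis (Fin 2) ℚ K)
    [IsFractionRing (endOrder (Algebra.leftMulMatrix μ)) K] :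
    Nat.card (Quot fun M N : {M : FractionalIdeal (endOrder (Algebra.leftMulMatrix μ))⁰ K // M ≠ 0} =>
      ∃ x : K, x ≠ 0 ∧ (M : FractionalIdeal (endOrder (Algebra.leftMulMatrix μ))⁰ K) =
        spanSingleton (endOrder (Algebra.leftMulMatrix μ))⁰ x * N) =
      ∑ S ∈ (EndOrder.finite_setOf_overorder (ρ := Algebra.leftMulMatrix μ) (K := K)).toFinset,
        Nat.card (ClassGroup S) := by
  rw [EndOrder.natCard_quot_fractionalIdeal_eq_sum_natCard_quot_stratum]
  refine Finset.sum_congr rfl fun S hS => ?_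
  rw [Set.Finite.mem_toFinset] at hS
  obtain ⟨ν, -, hν⟩ := exists_basis_coe_span_eq_and_endOrder_eq μ hS.1 hS.2
  subst hν
  exact natCard_quot_stratum_eq_natCard_classGroup μ ν hS.1

/-- **`#Pic(𝔬) ≤ #ICM(𝔬)`** («`Pic(R) ⊆ ICM(R)` … equality holds if and only if `R = 𝒪_K`»): the invertible classes
are one stratum. [cite: Marseglia2019, §3 Def. 3.5 and the remark after it, p. 6] -/
theorem natCard_classGroup_le_natCard_quot_fractionalIdeal (μ : Basis (Fin 2) ℚ K)
    [IsFractionRing (endOrder (Algebra.leftMulMatrix μ)) K] :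
    Nat.card (ClassGroup (endOrder (Algebra.leftMulMatrix μ))) ≤
      Nat.card (Quot fun M N : {M : FractionalIdeal (endOrder (Algebra.leftMulMatrix μ))⁰ K // M ≠ 0} =>
        ∃ x : K, x ≠ 0 ∧ (M : FractionalIdeal (endOrder (Algebra.leftMulMatrix μ))⁰ K) =
          spanSingleton (endOrder (Algebra.leftMulMatrix μ))⁰ x * N) := by
  classical
  rw [natCard_quot_fractionalIdeal_eq_sum_natCard_classGroup μ, ← natCard_quot_stratum_self_eq_natCard_classGroup μ,
    natCard_quot_stratum_self_eq_natCard_classGroup μ]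
  have hmem : endOrder (Algebra.leftMulMatrix μ) ∈
      (EndOrder.finite_setOf_overorder (ρ := Algebra.leftMulMatrix μ) (K := K)).toFinset := by
    rw [Set.Finite.mem_toFinset]
    exact ⟨le_rfl, CMTypeLattice.finite_endOrder (Algebra.leftMulMatrix μ)⟩
  exact Finset.single_le_sum (f := fun S : Subring K => Nat.card (ClassGroup S)) (fun _ _ => Nat.zero_le _) hmem

end Count

/-! ## §4 Validation `ℤ[√-3]`: `Σ_S #Pic(S) = #ICM(ℤ[√-3]) = 2` -/

namespace EisensteinTwo

/-- **`Σ_{S ⊇ ℤ[√-3]} #Pic(S) = 2`**: the Picard groups of the over-orders of `R = ℤ[√-3]` (namely `R` and `ℤ[ζ₃]`,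
both with trivial Picard group) account for the TWO classes `[R]`, `[𝔭₂]` of `ICM(ℤ[√-3])`
(`CMOrderIdealClassMonoidFinite.natCard_quot_fractionalIdeal_eq_two`) — the count `#ICM = Σ #Pic` checked on the
example. [cite: Marseglia2019, §3 Prop. 3.7, p. 6] [cite: Stevenhagen2008NumberRings, §4 Examples 4.2 and Example 6.9, pp. 217, 226] -/
theorem sum_overorders_natCard_classGroup_eq_two :
    ∑ S ∈ (EndOrder.finite_setOf_overorder (ρ := Algebra.leftMulMatrix basis) (K := K₃)).toFinset,
      Nat.card (ClassGroup S) = 2 := by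
  rw [← natCard_quot_fractionalIdeal_eq_sum_natCard_classGroup basis, natCard_quot_fractionalIdeal_eq_two]

end EisensteinTwo

end CMTypeLattice

end Literature.NumberTheory.ComplexMultiplication
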